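import Literature.IUT.HodgeTheaters.PuncturedEllipticCoveringsCuspsProofs
import Literature.IUT.HodgeTheaters.LabelsPlusMinusOfCuspTorsors
import HarnessLib

/-!
# The `𝔽_l^±`-GROUP / `𝔽_l^±`-TORSOR of cusps of `X̲` from abc-iut-L5-t1's `CuspGalois` ([IUTchI] Def 6.1 (iii)(v),
# [EtTh] Cor 2.9): the chart based at the zero cusp `ε⁰` — KIT-INSTANCE-SPEC P5-binding, LABEL slots at the MODEL
# (defs — post-freeze additive D13, not a cone member)

S. Mochizuki, *Inter-universal Teichmüller theory I*, kurims manuscript (May 2020), §4 p. 95 (`𝔽_l^±`-groups and -torsors),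
Def 6.1 (iii) p. 156 («`LabCusp^±(†𝒟_v) ⥲ 𝔽_l` well-defined up to multiplication by `±1`, zero element `†η⁰_v`»),
Def 6.1 (v) p. 158 («the cusp `ε̲` determines a natural `𝔽_l^±`-group structure»; «`ι̲` fixes `ε̲⁰` and switches `ε̲′, ε̲″`»)
([IUTchI] Def 6.1 (v) p.158) [claim: Mochizuki2012, status: disputed] (D-0012 claim key, series status DISPUTED — definitions
over abc-iut-L5-t1's K-level `PuncturedEllipticData` and its IR-A companion `CuspGalois` (p424023, proofs p424xxx); nothing
of the series is asserted, no side is taken on [IUTchIII] Cor. 3.12).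

WHAT IS BUILT (t13's design constraints (K1)(K2), INBOX 05:33Z, honoured: the chart is BASED AT `ε⁰`).  For
`D : PuncturedEllipticData`, `C : D.CuspGalois`, `hl : [Π_X : Π_X̲] = l` (at the instance: `ThetaGeometry.PiXbar_relIndex`),
`hι : ¬ Π_C̲ ≤ Π_X` (the deck involution exists; at the instance: index `2`):
* `CuspGalois.gen` — an element of `Π_X` carrying `ε⁰` to `ε′` (its action `σ` on cusps is INDEPENDENT of the choice,
  `act_eq_sigma_of_apply_ε0`); `sigma_pow_l : σ^l = 1`;
* `CuspGalois.labFun k := σ^k ε⁰`, a BIJECTION `ZMod l → Cusp(X̲)` (`labFun_bijective`: free + transitive + order `l`), and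
  **`CuspGalois.labChart : D.Cusp ≃ ZMod l`**, `labChart_ε0 = 0` **(K1)**, `labChart_ε1 = 1`;
* **`CuspGalois.labPM : FlPMGroup l D.Cusp`** — the `𝔽_l^±`-GROUP structure `{±labChart}` (Def 6.1 (v) "natural `𝔽_l^±`-group
  structure" determined by `ε̲`), `labT := labPM.toTorsor` the `𝔽_l^±`-TORSOR (Def 6.1 (iii)), `labChart_mem_charts`;
* how `Π_C̲` acts in the chart: `labChart_act_of_mem_PiX` — `g ∈ Π_X` acts by the TRANSLATION `+ labChart (g·ε⁰)`;
  **`labChart_act_of_not_mem_PiX`** — `c ∈ Π_C̲ ∖ Π_X` (the deck involution `ι̲`) acts by `z ↦ −z` **(K2 input for (I2)(ii))**: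
  in the `𝔽_l^⋊±` coordinates of the chart based at `ε⁰`, `ι̲` IS `(0, −1)`; `act_mem_autPM` — every element of `Π_C̲` acts
  through `Aut_±`-type bijections (`labPM.toTorsor.autPM`).
No instance/notation declared; typed ≠ proved elsewhere.
-/

noncomputable section

namespace Literature.IUT.HodgeTheaters

namespace PuncturedEllipticData

namespace CuspGalois

universe u

variable {D : PuncturedEllipticData.{u}} (C : D.CuspGalois) {l : ℕ}

/-! ### The generator `σ` (carrying `ε⁰ ↦ ε′`) -/

/-- An element of `Π_X` carrying the zero cusp `ε⁰` to `ε′` (exists by transitivity; its ACTION on cusps is independent of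
the choice, `act_eq_sigma_of_apply_ε0`). ([IUTchI] Def 6.1 (v) p.158) [claim: Mochizuki2012, status: disputed] -/
def gen : D.PiC := (C.transitive D.ε0 D.ε1).choose

/-- `gen ∈ Π_X`. ([IUTchI] Def 6.1 (v) p.158) [claim: Mochizuki2012, status: disputed] -/
theorem gen_mem : C.gen ∈ D.PiX := (C.transitive D.ε0 D.ε1).choose_spec.1

/-- `gen · ε⁰ = ε′`. ([IUTchI] Def 6.1 (v) p.158) [claim: Mochizuki2012, status: disputed] -/
theorem act_gen_ε0 : C.act C.gen D.ε0 = D.ε1 := (C.transitive D.ε0 D.ε1).choose_spec.2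

/-- The permutation `σ := act gen` of the cusps ("`+1`" in the group law with origin `ε⁰`).
([IUTchI] Def 6.1 (v) p.158) [claim: Mochizuki2012, status: disputed] -/
def sigma : Equiv.Perm D.Cusp := C.act C.gen

/-- `σ ε⁰ = ε′`. ([IUTchI] Def 6.1 (v) p.158) [claim: Mochizuki2012, status: disputed] -/
theorem sigma_ε0 : C.sigma D.ε0 = D.ε1 := C.act_gen_ε0

/-- `σ` does not depend on the choice of `gen`: any `g ∈ Π_X` with `g·ε⁰ = ε′` acts as `σ` (freeness).
([IUTchI] Def 6.1 (v) p.158) [claim: Mochizuki2012, status: disputed] -/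
theorem act_eq_sigma_of_apply_ε0 {g : D.PiC} (hg : g ∈ D.PiX) (h : C.act g D.ε0 = D.ε1) : C.act g = C.sigma :=
  C.act_eq_act_of_apply_eq hg C.gen_mem D.ε0 (by rw [h, C.act_gen_ε0])

/-- `σ^n = act (gen^n)`. ([IUTchI] Def 6.1 (v) p.158) [claim: Mochizuki2012, status: disputed] -/
theorem sigma_pow (n : ℕ) : C.sigma ^ n = C.act (C.gen ^ n) := by
  rw [sigma, map_pow]

/-- `gen ∉ Π_X̲` (it moves `ε⁰`). ([IUTchI] Def 6.1 (v) p.158) [claim: Mochizuki2012, status: disputed] -/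
theorem gen_not_mem_PiXbar : C.gen ∉ D.PiXbar := by
  intro h
  have h1 := C.act_apply_eq_self_of_mem_PiXbar h D.ε0
  rw [C.act_gen_ε0] at h1
  exact D.ε1_ne_ε0 h1

/-- **`σ^l = 1`**: `gen^l ∈ Π_X̲` because `Π_X/Π_X̲` has order `l` (`hl`), and `Π_X̲` acts trivially.
([IUTchI] Def 6.1 (v) p.158) [claim: Mochizuki2012, status: disputed] -/
theorem sigma_pow_l (hl : D.PiXbar.relIndex D.PiX = l) : C.sigma ^ l = 1 := by
  rw [sigma_pow]
  apply C.act_eq_one_of_mem_PiXbar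
  haveI := C.normal_PiXbar_subgroupOf
  have hidx : (D.PiXbar.subgroupOf D.PiX).index = l := hl
  have h := Subgroup.pow_index_mem (D.PiXbar.subgroupOf D.PiX) ⟨C.gen, C.gen_mem⟩
  rw [Subgroup.mem_subgroupOf, hidx, Subgroup.coe_pow] at h
  exact h

/-- `σ^n` depends only on `n mod l`. ([IUTchI] Def 6.1 (v) p.158) [claim: Mochizuki2012, status: disputed] -/
theorem sigma_pow_mod (hl : D.PiXbar.relIndex D.PiX = l) (n : ℕ) : C.sigma ^ (n % l) = C.sigma ^ n := by
  conv_rhs => rw [← Nat.mod_add_div n l, pow_add, pow_mul, C.sigma_pow_l hl, one_pow, mul_one]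

/-- `gen^n ∈ Π_X̲ ↔ l ∣ n` (the class of `gen` generates the order-`l` quotient, `l` prime).
([IUTchI] Def 6.1 (v) p.158) [claim: Mochizuki2012, status: disputed] -/
theorem gen_pow_mem_PiXbar_iff [hp : Fact l.Prime] (hl : D.PiXbar.relIndex D.PiX = l) (n : ℕ) :
    C.gen ^ n ∈ D.PiXbar ↔ l ∣ n := by
  haveI := C.normal_PiXbar_subgroupOf
  -- in the quotient `Q := Π_X / Π_X̲` the class `q` of `gen` has order `l`
  let q : D.PiX ⧸ D.PiXbar.subgroupOf D.PiX := QuotientGroup.mk ⟨C.gen, C.gen_mem⟩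
  have hq1 : q ≠ 1 := by
    intro h
    apply C.gen_not_mem_PiXbar
    have h' := (QuotientGroup.eq_one_iff _).mp h
    rwa [Subgroup.mem_subgroupOf] at h'
  have hql : q ^ l = 1 := by
    have hidx : (D.PiXbar.subgroupOf D.PiX).index = l := hl
    have h := Subgroup.pow_index_mem (D.PiXbar.subgroupOf D.PiX) ⟨C.gen, C.gen_mem⟩
    rw [hidx] at h
    change QuotientGroup.mk (⟨C.gen, C.gen_mem⟩ ^ l) = (1 : D.PiX ⧸ D.PiXbar.subgroupOf D.PiX)
    exact (QuotientGroup.eq_one_iff _).mpr h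
  have hord : orderOf q = l := orderOf_eq_prime hql hq1
  have key : C.gen ^ n ∈ D.PiXbar ↔ q ^ n = 1 := by
    rw [show q ^ n = QuotientGroup.mk (⟨C.gen, C.gen_mem⟩ ^ n) from rfl, QuotientGroup.eq_one_iff,
      Subgroup.mem_subgroupOf]
    rfl
  rw [key, orderOf_dvd_iff_pow_eq_one.symm, hord]

/-! ### The chart based at `ε⁰` -/

/-- `k ↦ σ^k · ε⁰`. ([IUTchI] Def 6.1 (v) p.158) [claim: Mochizuki2012, status: disputed] -/
def labFun (k : ZMod l) : D.Cusp := (C.sigma ^ k.val) D.ε0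

/-- `labFun` is injective (freeness + the order of `σ` is `l`). ([IUTchI] Def 6.1 (v) p.158) [claim: Mochizuki2012, status: disputed] -/
theorem labFun_injective [hp : Fact l.Prime] (hl : D.PiXbar.relIndex D.PiX = l) :
    Function.Injective (C.labFun (l := l)) := by
  intro a b hab
  simp only [labFun] at hab
  -- reduce to `a.val = b.val` via `σ^{a.val} = σ^{b.val}` and the order of `gen` mod `Π_X̲`
  wlog hle : b.val ≤ a.val generalizing a b
  · exact (this hab.symm (not_le.mp hle).le).symm
  have hpow : C.sigma ^ a.val = C.sigma ^ b.val := by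
    rw [sigma_pow, sigma_pow] at hab ⊢
    exact C.act_eq_act_of_apply_eq (D.PiX.pow_mem C.gen_mem _) (D.PiX.pow_mem C.gen_mem _) D.ε0 hab
  have hdiff : C.sigma ^ (a.val - b.val) = 1 := by
    rw [pow_sub _ hle, hpow, mul_inv_cancel]
  have hmem : C.gen ^ (a.val - b.val) ∈ D.PiXbar := by
    rw [C.mem_PiXbar_iff_act_eq_one (D.PiX.pow_mem C.gen_mem _), ← sigma_pow, hdiff]
  rw [C.gen_pow_mem_PiXbar_iff hl] at hmem
  have hlt : a.val - b.val < l := lt_of_le_of_lt (Nat.sub_le _ _) (ZMod.val_lt a)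
  have h0 : a.val - b.val = 0 := Nat.eq_zero_of_dvd_of_lt hmem hlt
  exact ZMod.val_injective l (by omega)

include C in
/-- The cusps of `X̲` are finite, `l` in number. ([IUTchI] Def 6.1 (v) p.158) [claim: Mochizuki2012, status: disputed] -/
theorem natCard_cusp (hl : D.PiXbar.relIndex D.PiX = l) : Nat.card D.Cusp = l := C.card_cusp.trans hl

/-- **`labFun` is a bijection `ZMod l → Cusp(X̲)`** (injective between sets of the same finite cardinality `l`).
([IUTchI] Def 6.1 (v) p.158) [claim: Mochizuki2012, status: disputed] -/
theorem labFun_bijective [hp : Fact l.Prime] (hl : D.PiXbar.relIndex D.PiX = l) :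
    Function.Bijective (C.labFun (l := l)) := by
  haveI := C.finite_cusp
  refine (C.labFun_injective hl).bijective_of_nat_card_le ?_
  rw [C.natCard_cusp hl, Nat.card_zmod]

/-- **The chart of the cusps of `X̲` based at the zero cusp** (`ε⁰ ↦ 0`, `ε′ ↦ 1`): `Cusp(X̲) ≃ 𝔽_l` ([IUTchI] Def 6.1 (iii)
«`LabCusp^± ⥲ 𝔽_l` … well-defined up to multiplication by `±1`»; the other choice `ε″ ↦ 1` gives the negative chart).
([IUTchI] Def 6.1 (v) p.158) [claim: Mochizuki2012, status: disputed] -/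
def labChart [Fact l.Prime] (hl : D.PiXbar.relIndex D.PiX = l) : D.Cusp ≃ ZMod l :=
  (Equiv.ofBijective _ (C.labFun_bijective hl)).symm

/-- `labChart.symm k = σ^k · ε⁰`. ([IUTchI] Def 6.1 (v) p.158) [claim: Mochizuki2012, status: disputed] -/
theorem labChart_symm_apply [Fact l.Prime] (hl : D.PiXbar.relIndex D.PiX = l) (k : ZMod l) :
    (C.labChart hl).symm k = (C.sigma ^ k.val) D.ε0 := rfl

/-- `labChart (σ^k · ε⁰) = k`. ([IUTchI] Def 6.1 (v) p.158) [claim: Mochizuki2012, status: disputed] -/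
theorem labChart_sigma_pow_ε0 [Fact l.Prime] (hl : D.PiXbar.relIndex D.PiX = l) (k : ZMod l) :
    C.labChart hl ((C.sigma ^ k.val) D.ε0) = k := by
  rw [← labChart_symm_apply C hl k, Equiv.apply_symm_apply]

/-- `labChart (σ^n · ε⁰) = n` for a natural exponent. ([IUTchI] Def 6.1 (v) p.158) [claim: Mochizuki2012, status: disputed] -/
theorem labChart_sigma_npow_ε0 [Fact l.Prime] (hl : D.PiXbar.relIndex D.PiX = l) (n : ℕ) :
    C.labChart hl ((C.sigma ^ n) D.ε0) = (n : ZMod l) := by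
  rw [← C.sigma_pow_mod hl n, ← ZMod.val_natCast (n := l) n, labChart_sigma_pow_ε0]

/-- **(K1)** the chart is based at the zero cusp: `labChart ε⁰ = 0`. ([IUTchI] Def 6.1 (iii) p.156) [claim: Mochizuki2012, status: disputed] -/
theorem labChart_ε0 [Fact l.Prime] (hl : D.PiXbar.relIndex D.PiX = l) : C.labChart hl D.ε0 = 0 := by
  have h := C.labChart_sigma_npow_ε0 hl 0
  rwa [pow_zero, Equiv.Perm.one_apply, Nat.cast_zero] at h

/-- `labChart ε′ = 1`. ([IUTchI] Def 6.1 (v) p.158) [claim: Mochizuki2012, status: disputed] -/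
theorem labChart_ε1 [Fact l.Prime] (hl : D.PiXbar.relIndex D.PiX = l) : C.labChart hl D.ε1 = 1 := by
  have h := C.labChart_sigma_npow_ε0 hl 1
  rwa [pow_one, C.sigma_ε0, Nat.cast_one] at h

/-! ### The `𝔽_l^±`-group and `𝔽_l^±`-torsor of cusps -/

/-- **The `𝔽_l^±`-GROUP of cusps of `X̲`** ([IUTchI] Def 6.1 (v) «the cusp `ε̲` determines a natural `𝔽_l^±`-group structure»):
charts `{labChart, −labChart}`. ([IUTchI] Def 6.1 (v) p.158) [claim: Mochizuki2012, status: disputed] -/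
def labPM [Fact l.Prime] (hl : D.PiXbar.relIndex D.PiX = l) : FlPMGroup l D.Cusp where
  charts := Set.range fun ε : ℤˣ => (C.labChart hl).trans (signPerm l ε)
  nonempty := ⟨(C.labChart hl).trans (signPerm l 1), 1, rfl⟩
  eq_orbit := by
    rintro e ⟨ε, rfl⟩
    ext σ'
    constructor
    · rintro ⟨η, rfl⟩
      refine ⟨η * ε⁻¹, ?_⟩
      ext z
      simp only [Equiv.trans_apply, signPerm_apply, smul_smul, inv_mul_cancel_right]
    · rintro ⟨η, rfl⟩
      refine ⟨η * ε, ?_⟩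
      ext z
      simp only [Equiv.trans_apply, signPerm_apply, smul_smul]

/-- `labChart` is a chart of the `𝔽_l^±`-group of cusps. ([IUTchI] Def 6.1 (v) p.158) [claim: Mochizuki2012, status: disputed] -/
theorem labChart_mem_charts [Fact l.Prime] (hl : D.PiXbar.relIndex D.PiX = l) :
    C.labChart hl ∈ (C.labPM hl).charts := by
  refine ⟨1, ?_⟩
  ext z
  simp only [Equiv.trans_apply, signPerm_apply, one_smul]

/-- Membership in the charts: `e` is `±labChart`. ([IUTchI] Def 6.1 (v) p.158) [claim: Mochizuki2012, status: disputed] -/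
theorem mem_labPM_charts_iff [Fact l.Prime] (hl : D.PiXbar.relIndex D.PiX = l) (e : D.Cusp ≃ ZMod l) :
    e ∈ (C.labPM hl).charts ↔ ∃ ε : ℤˣ, e = (C.labChart hl).trans (signPerm l ε) :=
  ⟨fun ⟨ε, h⟩ => ⟨ε, h.symm⟩, fun ⟨ε, h⟩ => ⟨ε, h.symm⟩⟩

/-- **The `𝔽_l^±`-TORSOR of cusps of `X̲`** ([IUTchI] Def 6.1 (iii): `LabCusp^± ⥲ 𝔽_l` up to `±1` and — for the torsor —
translation). ([IUTchI] Def 6.1 (iii) p.156) [claim: Mochizuki2012, status: disputed] -/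
def labT [Fact l.Prime] (hl : D.PiXbar.relIndex D.PiX = l) : FlPMTorsor l D.Cusp := (C.labPM hl).toTorsor

/-- `labChart` is a chart of the torsor. ([IUTchI] Def 6.1 (iii) p.156) [claim: Mochizuki2012, status: disputed] -/
theorem labChart_mem_labT_charts [Fact l.Prime] (hl : D.PiXbar.relIndex D.PiX = l) :
    C.labChart hl ∈ (C.labT hl).charts :=
  (C.labPM hl).mem_toTorsor_charts (C.labChart_mem_charts hl)

/-! ### How `Π_C̲` acts in the chart -/

/-- An element `g ∈ Π_X` acts on the cusps as `σ^m` with `m := labChart (g·ε⁰)` (freeness).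
([IUTchI] Def 6.1 (v) p.158) [claim: Mochizuki2012, status: disputed] -/
theorem act_eq_sigma_pow_of_mem_PiX [Fact l.Prime] (hl : D.PiXbar.relIndex D.PiX = l) {g : D.PiC} (hg : g ∈ D.PiX) :
    C.act g = C.sigma ^ (C.labChart hl (C.act g D.ε0)).val := by
  rw [sigma_pow]
  refine C.act_eq_act_of_apply_eq hg (D.PiX.pow_mem C.gen_mem _) D.ε0 ?_
  rw [← sigma_pow]
  exact ((C.labChart hl).symm_apply_apply (C.act g D.ε0)).symm.trans (C.labChart_symm_apply hl _)

/-- **`Π_X` acts by TRANSLATIONS in the chart**: `labChart (g·x) = labChart x + labChart (g·ε⁰)` for `g ∈ Π_X`.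
([IUTchI] Def 6.1 (v) p.158) [claim: Mochizuki2012, status: disputed] -/
theorem labChart_act_of_mem_PiX [Fact l.Prime] (hl : D.PiXbar.relIndex D.PiX = l) {g : D.PiC} (hg : g ∈ D.PiX)
    (x : D.Cusp) : C.labChart hl (C.act g x) = C.labChart hl x + C.labChart hl (C.act g D.ε0) := by
  set m := C.labChart hl (C.act g D.ε0) with hm
  set k := C.labChart hl x with hk
  have hx : x = (C.sigma ^ k.val) D.ε0 := by
    rw [← C.labChart_symm_apply hl k, hk, Equiv.symm_apply_apply]
  rw [C.act_eq_sigma_pow_of_mem_PiX hl hg, ← hm, hx, ← Equiv.Perm.mul_apply, ← pow_add,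
    C.labChart_sigma_npow_ε0 hl, Nat.cast_add, ZMod.natCast_zmod_val, ZMod.natCast_zmod_val, add_comm]

/-- **The deck involution acts by `z ↦ −z` in the chart based at `ε⁰`**: for `c ∈ Π_C̲ ∖ Π_X`,
`labChart (c·x) = − labChart x` (it fixes `ε⁰` — `act_ε0` — and inverts `Π_X/Π_X̲` — `act_act_of_mem_PiCbar`); i.e. in the
`𝔽_l^⋊±`-coordinates of the chart, `ι̲` is `(0, −1)` **((K2) input for (I2)(ii))**. ([IUTchI] Def 6.1 (v) p.158) [claim: Mochizuki2012, status: disputed] -/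
theorem labChart_act_of_not_mem_PiX [Fact l.Prime] (hl : D.PiXbar.relIndex D.PiX = l) {c : D.PiC} (hc : c ∈ D.PiCbar)
    (hcX : c ∉ D.PiX) (x : D.Cusp) : C.labChart hl (C.act c x) = - C.labChart hl x := by
  set k := C.labChart hl x with hk
  have hx : x = (C.sigma ^ k.val) D.ε0 := by
    rw [← C.labChart_symm_apply hl k, hk, Equiv.symm_apply_apply]
  have hgk : C.gen ^ k.val ∈ D.PiX := D.PiX.pow_mem C.gen_mem _
  rw [hx, C.sigma_pow, C.act_act_of_mem_PiCbar hc hcX hgk, C.act_ε0 c hc, map_inv]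
  -- `(σ^k)⁻¹ ε⁰ = σ^{(-k).val} ε⁰`
  have hinv : (C.act (C.gen ^ k.val))⁻¹ = C.sigma ^ (l - k.val) := by
    rw [← sigma_pow, inv_eq_iff_mul_eq_one, ← pow_add, Nat.add_sub_cancel' (le_of_lt (ZMod.val_lt k)),
      C.sigma_pow_l hl]
  rw [hinv, C.labChart_sigma_npow_ε0 hl, Nat.cast_sub (le_of_lt (ZMod.val_lt k)), ZMod.natCast_self,
    ZMod.natCast_zmod_val, zero_sub]

/-- In chart coordinates: `labChart ∘ (act c) ∘ labChart⁻¹ = signPerm (−1)` for `c ∈ Π_C̲ ∖ Π_X`.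
([IUTchI] Def 6.1 (v) p.158) [claim: Mochizuki2012, status: disputed] -/
theorem labChart_conj_act_of_not_mem_PiX [Fact l.Prime] (hl : D.PiXbar.relIndex D.PiX = l) {c : D.PiC}
    (hc : c ∈ D.PiCbar) (hcX : c ∉ D.PiX) :
    (C.labChart hl).symm.trans ((C.act c).trans (C.labChart hl)) = signPerm l (-1) := by
  ext z
  simp only [Equiv.trans_apply]
  rw [C.labChart_act_of_not_mem_PiX hl hc hcX, Equiv.apply_symm_apply, signPerm_apply, Units.neg_smul, one_smul]

/-- The deck involution is an automorphism of the `𝔽_l^±`-group of cusps: `labChart ∘ act c = (−labChart)`, a chart.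
([IUTchI] Def 6.1 (v) p.158) [claim: Mochizuki2012, status: disputed] -/
theorem act_trans_labChart_mem_charts_of_not_mem_PiX [Fact l.Prime] (hl : D.PiXbar.relIndex D.PiX = l) {c : D.PiC}
    (hc : c ∈ D.PiCbar) (hcX : c ∉ D.PiX) : (C.act c).trans (C.labChart hl) ∈ (C.labPM hl).charts := by
  refine ⟨-1, ?_⟩
  change (C.labChart hl).trans (signPerm l (-1)) = _
  rw [← C.labChart_conj_act_of_not_mem_PiX hl hc hcX, ← Equiv.trans_assoc, Equiv.self_trans_symm, Equiv.refl_trans]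

end CuspGalois

end PuncturedEllipticData

end Literature.IUT.HodgeTheaters
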